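import Mathlib
import Summits.NavierStokesRegularity.NavierStokesRegularity.Theorems.LerayQuarterDissipationFiniteDissipationLiouvilleVelocityLSix
import Summits.NavierStokesRegularity.NavierStokesRegularity.Theorems.LerayQuarterDissipationFiniteDissipationLiouvilleVorticityLThreeWall
import HarnessLib

/-!
# Crux `FiniteDissipationLiouville` (stmt-NavierStokesRegularity-22144): the `L⁶`-velocity rung —
# LAW-FREE forms (enveloped Type-I ancient fields; the catalogued DSS wall on the sub-class, every
# factor) and the proved region of the crux in `(C, K, C_ω, V₃, V₆)`

Theorems file of route `LerayQuarterDissipation` (lead prover g16; `--supports` the crux; corollaries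
of `…VelocityLSix` with the route's hardness bridge `…Hardness` and `…VorticityLThreeWall`).
Navier–Stokes regularity is NOT proved by anything here; no summit is.

A Type-I envelope `‖V(t,x)‖ ≤ C₀/(‖x‖ + √(−t))` yields the quarter-rate dissipation law
(`Hardness.exists_dissipationLaw_of_hasTypeIDecay`), so the `L⁶`-velocity rung (valid for EVERY
dissipation constant) becomes law-free:

* `eq_zero_of_typeI_envelope_of_velocityLSix_lt` — **a Type-I ancient mild field (KNSS gauge, any
  `C`) with a Type-I envelope and `∫⁻‖V(t)‖ₑ⁶ ≤ w⁶/(√(−t))³` for all `t < 0`, `KS²w⁴ < 64/27`, vanishes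
  identically** (no self-similarity assumed);
* `eq_zero_of_typeI_dss_of_velocityLSix_lt` — in particular Bradshaw–Tsai OP 5.1 holds, for EVERY
  factor `c > 1`, on the sub-class `KS²·sup_t (−t)^{1/2}‖V(t)‖⁴_{L⁶} < 64/27`;
* `exists_gaps_not_singular_of_region₅` — bookkeeping: THE PROVED REGION of the crux in the five
  scale-invariant parameters `(C, K, C_ω, V₃, V₆)` = `…VorticityLThreeWall.exists_gaps_not_singular_of_region₄`
  ∪ `{KS²V₆⁴ < 64/27}`.

HONEST FRAMING. Restrictions of the catalogued open problem / of the crux to explicit sub-classes;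
`KS` is Mathlib's non-sharp Gagliardo–Nirenberg–Sobolev constant; the wall and the crux beyond these
regions stay OPEN (FRONTIER); nothing here bears on Navier–Stokes regularity or blow-up.

References: Bradshaw–Tsai, Comm. PDE 42 (2017) OP 5.1; Koch–Nadirashvili–Seregin–Šverák 2009 §4;
folklore energy method.
-/

noncomputable section

set_option linter.dupNamespace false

namespace Summit.NavierStokesRegularity.NavierStokesRegularity.Theorems.FiniteDissipationLiouville.VelocityLSix

open MeasureTheory Set Filter Topology Metric Function
open scoped ENNReal
open Literature.Analysis Literature.Analysis.FluidPDE
open Summit.NavierStokesRegularity.NavierStokesRegularity.Theorems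
open Summit.NavierStokesRegularity.NavierStokesRegularity.Theorems.FiniteDissipationLiouville

variable {C C₀ : ℝ} {V : ℝ → EuclideanSpace ℝ (Fin 3) → EuclideanSpace ℝ (Fin 3)}

/-- **Enveloped Type-I ancient fields below the `L⁶`-velocity threshold vanish** (no
self-similarity, no dissipation law assumed): the envelope gives the law
(`Hardness.exists_dissipationLaw_of_hasTypeIDecay`) and `eq_zero_of_velocityLSix_lt` holds for every
dissipation constant. [cite: KochNadirashviliSereginSverak2009, §4 (arXiv:0709.3599 p. 8)] -/
theorem eq_zero_of_typeI_envelope_of_velocityLSix_lt (hV : IsTypeIAncientMild C V)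
    (hdec : HasTypeIDecay C₀ V) {w : ℝ} (hw : 0 ≤ w)
    (hq : (SNormLESNormFDerivOfEqConst (EuclideanSpace ℝ (Fin 3))
        (volume : Measure (EuclideanSpace ℝ (Fin 3))) 2 : ℝ) ^ 2 * w ^ 4 < 64 / 27)
    (hu : ∀ t : ℝ, t < 0 → ∫⁻ x, ‖V t x‖ₑ ^ 6 ≤ ENNReal.ofReal (w ^ 6 / Real.sqrt (-t) ^ 3)) :
    ∀ t < 0, ∀ x, V t x = 0 := by
  obtain ⟨K', hlaw⟩ := Hardness.exists_dissipationLaw_of_hasTypeIDecay hV hdec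
  exact eq_zero_of_velocityLSix_lt hV hlaw hw hq hu

/-- **Bradshaw–Tsai OP 5.1 on the sub-class `KS²·V₆⁴ < 64/27`, every factor** (recorded in the
wall's quantifier shape; the self-similarity is not used). [cite: KochNadirashviliSereginSverak2009, §4 (arXiv:0709.3599 p. 8)] -/
theorem eq_zero_of_typeI_dss_of_velocityLSix_lt (hV : IsTypeIAncientMild C V)
    (hdec : HasTypeIDecay C₀ V) {c : ℝ} (_hc : 1 < c) (_hdss : IsDiscretelySelfSimilar c V)
    {w : ℝ} (hw : 0 ≤ w)
    (hq : (SNormLESNormFDerivOfEqConst (EuclideanSpace ℝ (Fin 3))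
        (volume : Measure (EuclideanSpace ℝ (Fin 3))) 2 : ℝ) ^ 2 * w ^ 4 < 64 / 27)
    (hu : ∀ t : ℝ, t < 0 → ∫⁻ x, ‖V t x‖ₑ ^ 6 ≤ ENNReal.ofReal (w ^ 6 / Real.sqrt (-t) ^ 3)) :
    ∀ t < 0, ∀ x, V t x = 0 :=
  eq_zero_of_typeI_envelope_of_velocityLSix_lt hV hdec hw hq hu

/-- **THE PROVED REGION OF `FiniteDissipationLiouville` IN `(C, K, C_ω, V₃, V₆)`.** For all `C, K`
there are `ε, ε', ε'' > 0` such that every Type-I ancient mild `ū` (KNSS gauge, constant `C`) obeying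
the quarter-rate law (constant `K`), with vorticity amplitude `≤ C_ω`, `L³`-vorticity law
`∫⁻‖curl ū(t)‖ₑ³ ≤ v³/(√(−t))³` and `L⁶`-velocity law `∫⁻‖ū(t)‖ₑ⁶ ≤ w⁶/(√(−t))³` (`v, w ≥ 0`) that
lies in ONE of the regions of `…VorticityLThreeWall.exists_gaps_not_singular_of_region₄` or in the
NEW region `KS²w⁴ < 64/27`, is bounded on a backward parabolic cylinder at the origin. Beyond:
FRONTIER. [folklore] -/
theorem exists_gaps_not_singular_of_region₅ (C K : ℝ) : ∃ ε : ℝ, 0 < ε ∧ ∃ ε' : ℝ, 0 < ε' ∧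
    ∃ ε'' : ℝ, 0 < ε'' ∧
    ∀ (ū : ℝ → EuclideanSpace ℝ (Fin 3) → EuclideanSpace ℝ (Fin 3)) (Cω v w : ℝ),
      IsTypeIAncientMild C ū →
      (∀ s : ℝ, s < 0 → ∫⁻ x, ‖fderiv ℝ (ū s) x‖ₑ ^ 2 ≤ ENNReal.ofReal (K / Real.sqrt (-s))) →
      (∀ t : ℝ, t < 0 → ∀ x, (-t) * ‖curl (ū t) x‖ ≤ Cω) →
      0 ≤ v →
      (∀ t : ℝ, t < 0 → ∫⁻ x, ‖curl (ū t) x‖ₑ ^ 3 ≤ ENNReal.ofReal (v ^ 3 / Real.sqrt (-t) ^ 3)) →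
      0 ≤ w →
      (∀ t : ℝ, t < 0 → ∫⁻ x, ‖ū t x‖ₑ ^ 6 ≤ ENNReal.ofReal (w ^ 6 / Real.sqrt (-t) ^ 3)) →
      (C ≤ 1 + ε ∨
        (Real.sqrt (max K 0) * Real.sqrt (SNormLESNormFDerivOfEqConst (EuclideanSpace ℝ (Fin 3))
        (volume : Measure (EuclideanSpace ℝ (Fin 3))) 2 : ℝ) ^ 3) ^ 4 ≤ 64 / 27 + ε' ∨
        Cω ≤ Real.sqrt 3 / 4 + ε'' ∨
        (∃ lam : ℝ, 0 < lam ∧ lam ≤ 1 ∧ lam ^ 2 * C ^ 2 + (1 - lam) * (4 * Cω * Real.sqrt 3 / 3) < 1) ∨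
        (SNormLESNormFDerivOfEqConst (EuclideanSpace ℝ (Fin 3))
        (volume : Measure (EuclideanSpace ℝ (Fin 3))) 2 : ℝ) ^ 2 * v ^ 2 < 3 ∨
        (SNormLESNormFDerivOfEqConst (EuclideanSpace ℝ (Fin 3))
        (volume : Measure (EuclideanSpace ℝ (Fin 3))) 2 : ℝ) ^ 6 * (Cω * (‖curlCLM‖ ^ 2 * max K 0)) ^ 2 < 27 ∨
        (SNormLESNormFDerivOfEqConst (EuclideanSpace ℝ (Fin 3))
        (volume : Measure (EuclideanSpace ℝ (Fin 3))) 2 : ℝ) ^ 2 * w ^ 4 < 64 / 27) →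
      ¬ (∀ r > 0, ∀ M : ℝ, ∃ t ∈ Set.Ioo (-(r ^ 2)) (0 : ℝ),
          ∃ x ∈ Metric.ball (0 : EuclideanSpace ℝ (Fin 3)) r, M < ‖ū t x‖) := by
  obtain ⟨ε, hε, ε', hε', ε'', hε'', hreg⟩ := VorticityLThree.exists_gaps_not_singular_of_region₄ C K
  refine ⟨ε, hε, ε', hε', ε'', hε'', fun ū Cω v w hū hlaw hω hv0 hω3 hw0 hu6 hcase => ?_⟩
  rcases hcase with h1 | h2 | h3 | h4 | h5 | h6 | h7
  · exact hreg ū Cω v hū hlaw hω hv0 hω3 (Or.inl h1)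
  · exact hreg ū Cω v hū hlaw hω hv0 hω3 (Or.inr (Or.inl h2))
  · exact hreg ū Cω v hū hlaw hω hv0 hω3 (Or.inr (Or.inr (Or.inl h3)))
  · exact hreg ū Cω v hū hlaw hω hv0 hω3 (Or.inr (Or.inr (Or.inr (Or.inl h4))))
  · exact hreg ū Cω v hū hlaw hω hv0 hω3 (Or.inr (Or.inr (Or.inr (Or.inr (Or.inl h5)))))
  · exact hreg ū Cω v hū hlaw hω hv0 hω3 (Or.inr (Or.inr (Or.inr (Or.inr (Or.inr h6)))))
  · exact not_singular_of_velocityLSix_lt hū hlaw hw0 h7 hu6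

end Summit.NavierStokesRegularity.NavierStokesRegularity.Theorems.FiniteDissipationLiouville.VelocityLSix

end
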